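import Mathlib
import Summits.Ventures.PercRepro2.HCov
import Summits.Ventures.PercRepro2.RootEdgeBern
import Summits.Ventures.PercRepro2.HCovPlusQuartic
import Summits.Ventures.PercRepro2.QuarticRootCross
import Summits.Ventures.PercRepro2.QuarticRootCrossOL
import Summits.Ventures.PercRepro2.QuarticRootSlack
import Summits.Ventures.PercRepro2.QuarticRootSlackSign

/-!
# THE ROOT-EDGE FACE OF THE QUARTIC WITH THE FULL CROSS TERM: THE TWO OPEN STATEMENTS (F4), (F6)
(blind cell PercRepro2, p5 g18; `proofs/P5-OEDGE.md` §24 addendum 3)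

With `B2 ≥ 0` (`RootEdge.B2_nonneg_root`) and (HCOV) at the closed pin, the root-edge face
`0 ≤ H1 ∧ 0 ≤ H2` of the quartic road (`JointGood`) follows from two closed-pin inequalities in
which the cross term `c = covUm` appears IN FULL (`c = D₀·P₀(PD, o ↔ a₃) + δ'_oL − δ_oH`,
`QuarticRootCross.covUm_root_decomp` + `PDoL_mul_T'_le`):

* **`H2_nonneg_root_of_F6`**: `0 ≤ Q₁·B1 + c·slackBm` gives `0 ≤ H2` (`H2 = Q₀·B2 + Q₁·B1 + c·slackBm`);
* **`H1_nonneg_root_of_F4`**: `0 ≤ Q₀·B1 + covU₀·slackBm + c·slackB₀` and (HCOV) at the closed pin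
  give `0 ≤ H1` (`H1 = Q₀·B1 + Q₁·Gc₀ + covU₀·slackBm + c·slackB₀`);
* **`HCovPlus_of_update_zero_root_of_F`**: (HCOV) ∧ (HCOV⁺) at the closed pin and (F4) ∧ (F6) give
  (HCOV⁺) at `p`.

Both hypotheses are census-clean under the ES adversary (kit j285399: 0 negatives each on
5,928,930 root-edge lines with 14,581 lines of `c < 0`), unlike their crude forms with `δ_oH` in
place of `c⁻` (§24 addendum 2); neither is a theorem. They are the root-edge face of record.
-/

namespace Summit.Ventures.PercRepro2

open UnionCluster CovForm CovForm.EdgeLine CovForm.RootEdge PendantA3 CPolarSubPlus HCovPlusQuartic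

namespace QuarticRootCross

section FaceFull

variable {V : Type*} {E : Type*} [Fintype V] [DecidableEq V] [Fintype E] [DecidableEq E]
  {R : Type*} [Field R] [LinearOrder R] [IsStrictOrderedRing R]

variable {ends : E → Sym2 V} {e : E} {a₁ a₃ : V}

/-- **(F6) gives `0 ≤ H2` at a root edge**: `0 ≤ Q₁·B1 + c·slackBm` (with `B2 ≥ 0`). -/
theorem H2_nonneg_root_of_F6 (p : E → R) (hp : IsProbVec p) (hends : ends e = s(a₁, a₃)) (o a₂ b : V)
    (hF6 : 0 ≤ prob (Function.update p e 1) (avoidAll ends a₂ {a₁}) * B1 p ends o a₁ a₂ a₃ b e +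
        covUm p ends o a₁ a₂ a₃ e * slackBm p ends a₁ a₂ a₃ b e) :
    0 ≤ H2 p ends o a₁ a₂ a₃ b e := by
  have hp₀ : IsProbVec (Function.update p e 0) := hp.update e le_rfl zero_le_one
  rw [H2_eq_root p hends o a₂ b, ← covUm_eq_root p hends o a₂]
  have hB2 := B2_nonneg_root p hp hends o a₂ b
  have hQ0 := prob_nonneg hp₀ (avoidAll ends a₂ {a₁})
  have := mul_nonneg hQ0 hB2
  linarith

omit [Fintype V] [DecidableEq V] in
/-- **(F4) gives `0 ≤ H1` at a root edge**: `0 ≤ Q₀·B1 + covU₀·slackBm + c·slackB₀` (with (HCOV) at the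
closed pin). -/
theorem H1_nonneg_root_of_F4 (p : E → R) (hp : IsProbVec p) (hends : ends e = s(a₁, a₃)) (o a₂ b : V)
    (h₀ : HCov (Function.update p e 0) ends o a₁ a₂ a₃ b)
    (hF4 : 0 ≤ prob (Function.update p e 0) (avoidAll ends a₂ {a₁}) * B1 p ends o a₁ a₂ a₃ b e +
        covU (Function.update p e 0) ends o a₁ a₂ a₃ * slackBm p ends a₁ a₂ a₃ b e +
        covUm p ends o a₁ a₂ a₃ e * slackB (Function.update p e 0) ends a₁ a₂ a₃ b) :
    0 ≤ H1 p ends o a₁ a₂ a₃ b e := by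
  have hp₁ : IsProbVec (Function.update p e 1) := hp.update e zero_le_one le_rfl
  rw [H1_eq_root p hends o a₂ b, ← covUm_eq_root p hends o a₂]
  have hQ1 := prob_nonneg hp₁ (avoidAll ends a₂ {a₁})
  have hG : 0 ≤ Gc (Function.update p e 0) ends o a₁ a₂ a₃ b := h₀
  have := mul_nonneg hQ1 hG
  linarith

/-- **(HCOV⁺) across a root edge from (HCOV) ∧ (HCOV⁺) at the closed pin and (F4) ∧ (F6).** -/
theorem HCovPlus_of_update_zero_root_of_F (p : E → R) (hp : IsProbVec p)
    (hends : ends e = s(a₁, a₃)) (o a₂ b : V)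
    (h₀ : HCov (Function.update p e 0) ends o a₁ a₂ a₃ b)
    (h₀' : HCovPlus (Function.update p e 0) ends o a₁ a₂ a₃ b)
    (hF4 : 0 ≤ prob (Function.update p e 0) (avoidAll ends a₂ {a₁}) * B1 p ends o a₁ a₂ a₃ b e +
        covU (Function.update p e 0) ends o a₁ a₂ a₃ * slackBm p ends a₁ a₂ a₃ b e +
        covUm p ends o a₁ a₂ a₃ e * slackB (Function.update p e 0) ends a₁ a₂ a₃ b)
    (hF6 : 0 ≤ prob (Function.update p e 1) (avoidAll ends a₂ {a₁}) * B1 p ends o a₁ a₂ a₃ b e +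
        covUm p ends o a₁ a₂ a₃ e * slackBm p ends a₁ a₂ a₃ b e) :
    HCovPlus p ends o a₁ a₂ a₃ b :=
  HCovPlus_of_update_zero_root p hp hends o a₂ b h₀'
    (H1_nonneg_root_of_F4 p hp hends o a₂ b h₀ hF4) (H2_nonneg_root_of_F6 p hp hends o a₂ b hF6)

end FaceFull

end QuarticRootCross

end Summit.Ventures.PercRepro2
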